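import Summits.CriticalPhenomena.PercolationContinuityZ3.Theorems.PercNearOneGluingNoHeavyPcintAdaptiveDomination
import HarnessLib

/-!
# PCINT lane, king route, K1 tools: fibres of an adaptive run, and up-set dominance ⇒ monotone dominance

Cell `prim-pcint`, seat `prim-pcint-1` (gen 9); memo `run/shared/lean/prim/pcint/KING-ROUTE.md` §K1 (3).

Two generic lemmas for the Markov decomposition (K1 step (3)) feeding `AdaptDom.expect_le_of_dominating`:

* **Fibres of a run** (`AdaptDom.run_eq_iff_replay`): for a rule `R` examining only unrevealed sites, the set of
  oracles `x` with `run R x n = σ` is described by finitely many pointwise conditions — `σ` must be its own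
  replay (`run R (readOut σ) n = σ`, a condition on `σ` alone) and `x` must report, at each replayed state
  `run R (readOut σ) k` (`k < n`) and each examined site `a`, the value recorded in `σ`.  (Revealed values
  never change: `run_apply_of_ne_none`.)
* **Layer cake** (`AdaptDom.sum_mul_sum_le_of_upperSets`): on a finite preorder, if a nonnegative weight `L`
  dominates a probability weight `π` on every up-set (`(Σ L)·π(U) ≤ L(U)`), then `(Σ L)·(Σ π g) ≤ Σ L g` for
  every monotone `g` (induction on the number of points above the minimum of `g`).
-/

namespace Summit.CriticalPhenomena.PercolationContinuityZ3.Theorems.Pcint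

namespace AdaptDom

open Finset

variable {V : Type*} [Fintype V] [DecidableEq V]

/-! ### Revealed values persist; fibres of a run -/

/-- The oracle that reads the answers off a fixed state `σ` (unrevealed sites read `false`). -/
def readOut (σ : V → Option Bool) : (V → Option Bool) → V → Bool := fun _ v => (σ v).getD false

omit [Fintype V] in
/-- One step does not change revealed values (the rule examines only unrevealed sites). -/
theorem stepPA_apply_of_ne_none {R : (V → Option Bool) → Finset V} (hR : ∀ σ v, v ∈ R σ → σ v = none)
    (σ : V → Option Bool) (x : V → Bool) {v : V} (hv : σ v ≠ none) : stepPA (R σ) σ x v = σ v := by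
  unfold stepPA
  by_cases h : v ∈ R σ
  · exact absurd (hR σ v h) hv
  · rw [if_neg h]

omit [Fintype V] in
/-- **Revealed values persist along a run.** -/
theorem run_apply_of_ne_none {R : (V → Option Bool) → Finset V} (hR : ∀ σ v, v ∈ R σ → σ v = none)
    (x : (V → Option Bool) → V → Bool) {n : ℕ} {v : V} (hv : run R x n v ≠ none) :
    ∀ m, n ≤ m → run R x m v = run R x n v := by
  intro m hm
  induction m with
  | zero => rw [Nat.le_zero.1 hm]
  | succ m ih =>
    rcases Nat.lt_or_eq_of_le hm with h | h
    · have ih' := ih (Nat.lt_succ_iff.1 h)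
      have hne : run R x m v ≠ none := by rw [ih']; exact hv
      change stepPA (R (run R x m)) (run R x m) (x (run R x m)) v = _
      rw [stepPA_apply_of_ne_none hR _ _ hne, ih']
    · rw [h]

omit [Fintype V] in
/-- The value revealed at step `k + 1` on an examined site. -/
theorem run_succ_apply_of_mem {R : (V → Option Bool) → Finset V} (x : (V → Option Bool) → V → Bool) (k : ℕ)
    {a : V} (ha : a ∈ R (run R x k)) : run R x (k + 1) a = some (x (run R x k) a) := by
  change stepPA (R (run R x k)) (run R x k) (x (run R x k)) a = _
  simp [stepPA, ha]

omit [Fintype V] in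
/-- **Fibres of a run**: `run R x n = σ` iff `σ` is its own `n`-step replay and `x` reports, at every replayed
state before step `n` and every examined site, the value recorded in `σ`. -/
theorem run_eq_iff_replay {R : (V → Option Bool) → Finset V} (hR : ∀ σ v, v ∈ R σ → σ v = none)
    (x : (V → Option Bool) → V → Bool) (n : ℕ) (σ : V → Option Bool) :
    run R x n = σ ↔ run R (readOut σ) n = σ ∧
      ∀ k < n, ∀ a ∈ R (run R (readOut σ) k), x (run R (readOut σ) k) a = (σ a).getD false := by
  constructor
  · intro hrun
    -- the replay agrees with the run at every step `k ≤ n`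
    have agree : ∀ k ≤ n, run R (readOut σ) k = run R x k ∧
        ∀ j < k, ∀ a ∈ R (run R x j), x (run R x j) a = (σ a).getD false := by
      intro k hk
      induction k with
      | zero => exact ⟨rfl, fun j hj => absurd hj (Nat.not_lt_zero j)⟩
      | succ k ih =>
        obtain ⟨ih1, ih2⟩ := ih (Nat.le_of_succ_le hk)
        have hval : ∀ a ∈ R (run R x k), x (run R x k) a = (σ a).getD false := by
          intro a ha
          have h1 := run_succ_apply_of_mem x k ha
          have h2 := run_apply_of_ne_none hR x (n := k + 1) (v := a) (by rw [h1]; simp) n hk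
          rw [hrun] at h2
          rw [h2, h1]; rfl
        refine ⟨?_, fun j hj a ha => ?_⟩
        · change stepPA (R (run R (readOut σ) k)) (run R (readOut σ) k) (readOut σ (run R (readOut σ) k)) =
            stepPA (R (run R x k)) (run R x k) (x (run R x k))
          rw [ih1]
          funext v
          unfold stepPA
          by_cases hv : v ∈ R (run R x k)
          · rw [if_pos hv, if_pos hv, hval v hv]; rfl
          · rw [if_neg hv, if_neg hv]
        · rcases Nat.lt_succ_iff_lt_or_eq.1 hj with hj' | rfl
          · exact ih2 j hj' a ha
          · exact hval a ha
    obtain ⟨h1, h2⟩ := agree n le_rfl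
    refine ⟨h1.trans hrun, fun k hk a ha => ?_⟩
    have hk' := (agree k hk.le).1
    rw [hk'] at ha ⊢
    exact h2 k hk a ha
  · rintro ⟨hrep, hval⟩
    have agree : ∀ k ≤ n, run R x k = run R (readOut σ) k := by
      intro k hk
      induction k with
      | zero => rfl
      | succ k ih =>
        have ih' := ih (Nat.le_of_succ_le hk)
        change stepPA (R (run R x k)) (run R x k) (x (run R x k)) =
          stepPA (R (run R (readOut σ) k)) (run R (readOut σ) k) (readOut σ (run R (readOut σ) k))
        rw [ih']
        funext v
        unfold stepPA
        by_cases hv : v ∈ R (run R (readOut σ) k)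
        · rw [if_pos hv, if_pos hv, hval k (Nat.lt_of_succ_le hk) v hv]; rfl
        · rw [if_neg hv, if_neg hv]
    rw [agree n le_rfl, hrep]

/-! ### Up-set dominance implies dominance against monotone functions -/

section LayerCake

variable {X : Type*} [Fintype X] [Preorder X]

/-- **Layer cake**: if a weight `L` dominates a weight `π` of total mass `1` on every up-set, i.e.
`(Σ L) · Σ_{U} π ≤ Σ_{U} L`, then `(Σ L) · Σ π g ≤ Σ L g` for every monotone `g` (no sign conditions are
needed: `g` is a constant plus a nonnegative combination of indicators of up-sets). -/
theorem sum_mul_sum_le_of_upperSets [DecidableEq X] (L π : X → ℝ) (hπ1 : ∑ x, π x = 1)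
    (hU : ∀ U : Finset X, (∀ x ∈ U, ∀ y, x ≤ y → y ∈ U) → (∑ x, L x) * (∑ x ∈ U, π x) ≤ ∑ x ∈ U, L x)
    (g : X → ℝ) (hg : Monotone g) : (∑ x, L x) * (∑ x, π x * g x) ≤ ∑ x, L x * g x := by
  -- induction on the number of points where `g` exceeds its minimum value
  suffices key : ∀ (m : ℕ) (g : X → ℝ), Monotone g → (univ.filter fun x => ∃ y, g y < g x).card ≤ m →
      (∑ x, L x) * (∑ x, π x * g x) ≤ ∑ x, L x * g x from key _ g hg le_rfl
  intro m
  induction m with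
  | zero =>
    intro g hg hcard
    -- `g` is constant
    have hconst : ∀ x y, g x = g y := by
      intro x y
      by_contra hne
      rcases lt_or_gt_of_ne hne with h | h
      · have : y ∈ univ.filter fun x => ∃ y, g y < g x := mem_filter.2 ⟨mem_univ _, x, h⟩
        rw [Nat.le_zero, card_eq_zero] at hcard
        rw [hcard] at this; simp at this
      · have : x ∈ univ.filter fun x => ∃ y, g y < g x := mem_filter.2 ⟨mem_univ _, y, h⟩
        rw [Nat.le_zero, card_eq_zero] at hcard
        rw [hcard] at this; simp at this
    rcases isEmpty_or_nonempty X with hX | ⟨⟨x₀⟩⟩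
    · simp
    · have hg' : ∀ x, g x = g x₀ := fun x => hconst x x₀
      simp_rw [hg']
      rw [← Finset.sum_mul, ← Finset.sum_mul, hπ1, one_mul]
  | succ m ih =>
    intro g hg hcard
    rcases isEmpty_or_nonempty X with hX | hX
    · simp
    -- the minimum value of `g` and the up-set where `g` exceeds it
    obtain ⟨x₀, -, hx₀⟩ := exists_min_image univ g univ_nonempty
    set U : Finset X := univ.filter fun x => g x₀ < g x with hUdef
    by_cases hUe : U = ∅
    · -- `g` is constant
      have hg' : ∀ x, g x = g x₀ := by
        intro x
        have h1 := hx₀ x (mem_univ x)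
        rcases h1.lt_or_eq with h | h
        · have : x ∈ U := mem_filter.2 ⟨mem_univ _, h⟩
          rw [hUe] at this; simp at this
        · exact h.symm
      simp_rw [hg']
      rw [← Finset.sum_mul, ← Finset.sum_mul, hπ1, one_mul]
    · -- `δ` = the gap above the minimum; peel off `δ · 𝟙_U`
      obtain ⟨x₁, hx₁U, hx₁⟩ := exists_min_image U g (nonempty_iff_ne_empty.2 hUe)
      set δ := g x₁ - g x₀ with hδ
      have hδpos : 0 < δ := by have := (mem_filter.1 hx₁U).2; rw [hδ]; linarith
      have hUup : ∀ x ∈ U, ∀ y, x ≤ y → y ∈ U := fun x hx y hxy =>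
        mem_filter.2 ⟨mem_univ _, lt_of_lt_of_le (mem_filter.1 hx).2 (hg hxy)⟩
      let g' : X → ℝ := fun x => if x ∈ U then g x - δ else g x
      have hg'mono : Monotone g' := by
        intro x y hxy
        simp only [g']
        by_cases hx : x ∈ U
        · have hy : y ∈ U := hUup x hx y hxy
          rw [if_pos hx, if_pos hy]; linarith [hg hxy]
        · rw [if_neg hx]
          by_cases hy : y ∈ U
          · rw [if_pos hy]
            have h1 : g x = g x₀ := by
              rcases (hx₀ x (mem_univ x)).lt_or_eq with h | h
              · exact absurd (show x ∈ U from mem_filter.2 ⟨mem_univ _, h⟩) hx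
              · exact h.symm
            have h2 := hx₁ y hy
            rw [h1, hδ]; linarith
          · rw [if_neg hy]; exact hg hxy
      -- `g'` has fewer points above its minimum: they lie in `U \\ {x₁}`
      have hcard' : (univ.filter fun x => ∃ y, g' y < g' x).card ≤ m := by
        have hsub : (univ.filter fun x => ∃ y, g' y < g' x) ⊆ U.erase x₁ := by
          intro x hx
          obtain ⟨-, y, hy⟩ := mem_filter.1 hx
          simp only [g'] at hy
          rw [mem_erase]
          have hxU : x ∈ U := by
            by_contra hxU
            rw [if_neg hxU] at hy
            have hgx : g x = g x₀ := by
              rcases (hx₀ x (mem_univ x)).lt_or_eq with h | h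
              · exact absurd (show x ∈ U from mem_filter.2 ⟨mem_univ _, h⟩) hxU
              · exact h.symm
            by_cases hyU : y ∈ U
            · rw [if_pos hyU] at hy; have := hx₁ y hyU; rw [hgx] at hy; linarith
            · rw [if_neg hyU] at hy; have := hx₀ y (mem_univ y); linarith
          refine ⟨?_, hxU⟩
          rintro rfl
          rw [if_pos hxU] at hy
          by_cases hyU : y ∈ U
          · rw [if_pos hyU] at hy; have := hx₁ y hyU; linarith
          · rw [if_neg hyU] at hy
            have := hx₀ y (mem_univ y); rw [hδ] at hy; linarith
        have hUcard : U.card ≤ m + 1 := by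
          refine le_trans (card_le_card fun x hx => ?_) hcard
          exact mem_filter.2 ⟨mem_univ _, x₀, (mem_filter.1 hx).2⟩
        have := card_le_card hsub
        rw [card_erase_of_mem hx₁U] at this
        omega
      have ih' := ih g' hg'mono hcard'
      -- `g = g' + δ 𝟙_U`
      have hgg' : ∀ x, g x = g' x + δ * (if x ∈ U then 1 else 0) := by
        intro x; simp only [g']; split_ifs <;> ring
      have hUineq := hU U hUup
      simp_rw [hgg', mul_add, Finset.sum_add_distrib]
      rw [mul_add]
      apply add_le_add ih'
      -- the up-set term
      have e1 : ∑ x, π x * (δ * if x ∈ U then 1 else 0) = δ * ∑ x ∈ U, π x := by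
        rw [Finset.mul_sum, ← Finset.sum_filter_add_sum_filter_not univ (· ∈ U)]
        have hf : univ.filter (· ∈ U) = U := by ext x; simp
        rw [hf]
        have hz : ∑ x ∈ univ.filter (fun x => ¬ x ∈ U), π x * (δ * if x ∈ U then 1 else 0) = 0 :=
          Finset.sum_eq_zero fun x hx => by rw [if_neg (mem_filter.1 hx).2]; ring
        rw [hz, add_zero]
        exact Finset.sum_congr rfl fun x hx => by rw [if_pos hx]; ring
      have e2 : ∑ x, L x * (δ * if x ∈ U then 1 else 0) = δ * ∑ x ∈ U, L x := by
        rw [Finset.mul_sum, ← Finset.sum_filter_add_sum_filter_not univ (· ∈ U)]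
        have hf : univ.filter (· ∈ U) = U := by ext x; simp
        rw [hf]
        have hz : ∑ x ∈ univ.filter (fun x => ¬ x ∈ U), L x * (δ * if x ∈ U then 1 else 0) = 0 :=
          Finset.sum_eq_zero fun x hx => by rw [if_neg (mem_filter.1 hx).2]; ring
        rw [hz, add_zero]
        exact Finset.sum_congr rfl fun x hx => by rw [if_pos hx]; ring
      rw [e1, e2]
      calc (∑ x, L x) * (δ * ∑ x ∈ U, π x) = δ * ((∑ x, L x) * ∑ x ∈ U, π x) := by ring
        _ ≤ δ * ∑ x ∈ U, L x := mul_le_mul_of_nonneg_left hUineq hδpos.le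

end LayerCake

end AdaptDom

end Summit.CriticalPhenomena.PercolationContinuityZ3.Theorems.Pcint
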